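import Mathlib
import Literature.Computability.AlgebraicComplexity.StandardFamilies
import Literature.Computability.AlgebraicComplexity.HessianRank
import Literature.RingTheory.Nullstellensatz.SkodaBrownawellDegreeBound
import Summits.ValiantsHypothesis.ValiantsHypothesis.Theses.RefutationDegree
import Summits.ValiantsHypothesis.ValiantsHypothesis.Theorems.RefutationDegreeDefs
import Summits.ValiantsHypothesis.ValiantsHypothesis.Theorems.RefutationDegreeRefutationBarrierConverse
import Summits.ValiantsHypothesis.ValiantsHypothesis.Theorems.RefutationDegreeBeyondHessianNsKernelPlane
import Literature.Computability.AlgebraicComplexity.OrbitClosureProofs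

/-!
# Sketch (crux-ideate round 2, ideator 4) — idea `fano-by-one-border` for crux
`RefutationDegree.RefutationBarrier` (stmt-ValiantsHypothesis-5642), NEGATION lens

Typed first lemmas of the card `idea-fano-by-one-border.md`.  The line REFUTES the crux:

  border-robust kernel plane (L1) + homogeneity closure (L2)
    ⟹  `\overline{dc}_aff(per_n) ≥ n² − 𝔣_lin(y)` for every zero `y` of `per_n`
         (`𝔣_lin(y)` = largest dimension of a LINEAR subspace `W ∋ y` with `per_n|_W ≡ 0`);
  `FanoByOne n` (some zero `y` has `𝔣_lin(y) ≤ ⌊n²/2⌋ − 1`, one below the Lagrangian bound)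
    at infinitely many ODD `n`  ⟹  `¬ InBorder n (⌊n²/2⌋+1)` i.o.
    ⟹  `¬ RefutationBarrier`   (landed `not_refutationBarrier_of_io_notInBorder`, mod Skoda–Brownawell).

`stub_*` are the open lemmas (L1 provable now, size L; L2 `linearClosure` is PROVED here; the a-priori
Lagrangian bound is context; `FanoByOne` i.o. is the research content); the two compositions are kernel-checked.
-/

set_option linter.dupNamespace false

noncomputable section

namespace Summit.ValiantsHypothesis.ValiantsHypothesis.Cruxes.RefutationBarrier.FanoByOne

open MvPolynomial
open Literature.Computability.AlgebraicComplexity (perPoly hessianMatrix perPoly_isHomogeneous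
  eval_smul_of_isHomogeneous)
open Summit.ValiantsHypothesis.ValiantsHypothesis.Theorems.RefutationDegreeBeyondHessianNs (eval_aeval_line)
open Literature.RingTheory.Nullstellensatz (skodaBrownawellDegreeBound)
open Summit.ValiantsHypothesis.ValiantsHypothesis.Theses.RefutationDegree
open Summit.ValiantsHypothesis.ValiantsHypothesis.Theorems.RefutationDegree

/-- The affine flat `y + W` lies on the permanental hypersurface `{per_n = 0}`. -/
def FlatThrough (n : ℕ) (y : Fin n × Fin n → ℂ) (W : Submodule ℂ (Fin n × Fin n → ℂ)) : Prop :=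
  ∀ w ∈ W, eval (y + w) (perPoly (Fin n) ℂ) = 0

/-- `W` is a LINEAR per-null subspace: `per_n|_W ≡ 0`. -/
def PerNull (n : ℕ) (W : Submodule ℂ (Fin n × Fin n → ℂ)) : Prop :=
  ∀ w ∈ W, eval w (perPoly (Fin n) ℂ) = 0

/-- **FanoByOne n**: some zero `y` of `per_n` lies on no linear per-null subspace of dimension
`⌊n²/2⌋`, i.e. `𝔣_lin(y) ≤ ⌊n²/2⌋ − 1` — one below the a-priori Lagrangian bound
(`stub_aprioriLagrangian`).  Numerically `𝔣_lin(y₀) = 2n − 2` at the Mignon–Ressayre point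
(`n = 3, 4, 5`: kit j016868 / j016927 / j016991 of the sibling cruxes), so the expected margin at odd
`n ≥ 5` is `(n² − 4n + 3)/2`. -/
def FanoByOne (n : ℕ) : Prop :=
  ∃ y : Fin n × Fin n → ℂ, eval y (perPoly (Fin n) ℂ) = 0 ∧
    ∀ W : Submodule ℂ (Fin n × Fin n → ℂ), y ∈ W → PerNull n W →
      Module.finrank ℂ W + 1 ≤ n ^ 2 / 2

/-- **L1 — border-robust kernel plane** (first lemma of the card; provable now, size L).
If `per_n` is a coefficientwise limit of determinants of size-`m` affine pencils (`InBorder n m`),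
then through EVERY zero `y` of `per_n` there is an affine flat `y + W ⊆ {per_n = 0}` with
`dim W ≥ n² − m`.  Proof sketch: for the `k`-th pencil `A_k` pick (Hurwitz on a complex line through
`y`) a zero `y_k → y` of `f_k = det A_k`, a left-kernel vector `c_k` of `A_k(y_k)`, and the kernel
`K_k` (dim `≥ n² − m`) of `v ↦ c_k · A_k^{lin}(v)`; then `f_k ≡ 0` on `y_k + K_k` (exact kernel plane,
cf. landed `…BeyondHessianNs.exists_submodule_of_isAffineDetRepr`); orthonormal bases of the `K_k` have a
convergent subsequence (Stiefel compactness), the limit spans `W`, and `per_n(y + w) = lim f_k(y_k + w_k) = 0`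
by locally uniform convergence `f_k → per_n`.  FORMALISATION NOTE: for the compositions below it suffices to
prove this at a SMOOTH zero `y` (`∃ e, ∂_e per_n(y) ≠ 0`; the FanoByOne witness `y₀ = J − nE₁₁` is smooth): on a
complex line `y + s·w` with `∂_w per_n(y) ≠ 0` the zero `y_k` of `f_k` near `y` is produced by the Banach fixed-point
theorem for `s ↦ s − f_k(y + s w)/∂_w per_n(y)` on a small disc (Mathlib `ContractingWith`), replacing Hurwitz. -/
theorem stub_borderKernelPlane {n m : ℕ} (h : InBorder n m) (y : Fin n × Fin n → ℂ)
    (hy : eval y (perPoly (Fin n) ℂ) = 0) :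
    ∃ W : Submodule ℂ (Fin n × Fin n → ℂ), n ^ 2 ≤ Module.finrank ℂ W + m ∧ FlatThrough n y W := by
  sorry

/-- **L2 — homogeneity closure** (PROVED here).  A flat `y + W` on the CONE `{per_n = 0}` generates a
LINEAR per-null subspace `W + ℂ·y`: `a·y + z = a·(y + a⁻¹z)` is a zero for `a ≠ 0` by homogeneity, and
`t ↦ per_n(t·y + z)` is a polynomial with infinitely many roots, so it vanishes at `t = 0` too
(same closure as inside the landed `…BeyondHessianNs.exists_submodule_of_isAffineDetRepr`). -/
theorem linearClosure {n : ℕ} (y : Fin n × Fin n → ℂ) (W : Submodule ℂ (Fin n × Fin n → ℂ))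
    (hW : FlatThrough n y W) : PerNull n (W ⊔ (ℂ ∙ y)) := by
  classical
  intro w hw
  obtain ⟨z, hz, y', hy', rfl⟩ := Submodule.mem_sup.mp hw
  obtain ⟨a, rfl⟩ := Submodule.mem_span_singleton.mp hy'
  have hhom : (perPoly (Fin n) ℂ).IsHomogeneous n := by
    simpa [Fintype.card_fin] using (perPoly_isHomogeneous (n := Fin n) (k := ℂ))
  -- for `a ≠ 0`: `per(a • y + z) = a^n · per(y + a⁻¹ • z) = 0`
  have hne : ∀ a : ℂ, a ≠ 0 → eval (a • y + z) (perPoly (Fin n) ℂ) = 0 := by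
    intro a ha
    have hx : a • y + z = a • (y + a⁻¹ • z) := by
      rw [smul_add, smul_smul, mul_inv_cancel₀ ha, one_smul]
    rw [hx, eval_smul_of_isHomogeneous hhom, hW _ (W.smul_mem _ hz), mul_zero]
  have key : eval (a • y + z) (perPoly (Fin n) ℂ) = 0 := by
    by_cases ha : a = 0
    · subst ha
      set G := aeval (fun e => Polynomial.C (y e) * Polynomial.X + Polynomial.C (z e))
        (perPoly (Fin n) ℂ) with hG
      have hG0 : G = 0 := by
        apply Polynomial.eq_zero_of_infinite_isRoot
        refine Set.Infinite.mono (s := {t : ℂ | t ≠ 0}) ?_ ?_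
        · intro t ht
          simp only [Set.mem_setOf_eq, Polynomial.IsRoot.def]
          rw [hG, eval_aeval_line, hne t ht]
        · have : ({t : ℂ | t ≠ 0}) = ({0} : Set ℂ)ᶜ := by ext; simp
          rw [this]
          exact (Set.finite_singleton (0 : ℂ)).infinite_compl
      have := eval_aeval_line (perPoly (Fin n) ℂ) y z 0
      rw [← hG, hG0, Polynomial.eval_zero] at this
      rw [← this]
    · exact hne a ha
  rw [add_comm]
  exact key

/-- **A-priori Lagrangian bound** (context for "by one"; provable now from the tree's Hessian
infrastructure, size M): a linear per-null subspace through a zero `y` with non-degenerate Hessian is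
totally isotropic for `Hess per_n(y)` (second derivatives along `W` vanish), hence has dimension
`≤ ⌊n²/2⌋`; at the Mignon–Ressayre point the Hessian is non-degenerate (`rank_mrHess`). -/
theorem stub_aprioriLagrangian {n : ℕ} (y : Fin n × Fin n → ℂ)
    (hH : (hessianMatrix (perPoly (Fin n) ℂ) y).det ≠ 0)
    (W : Submodule ℂ (Fin n × Fin n → ℂ)) (hyW : y ∈ W) (hW : PerNull n W) :
    2 * Module.finrank ℂ W ≤ n ^ 2 := by
  sorry

/-- **Composition 1 (kernel-checked modulo L1): `FanoByOne` at odd `n` puts `per_n` OFF the affine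
border at the quadratic size `m₁ = ⌊n²/2⌋+1`** — i.e. `\overline{dc}_aff(per_n) ≥ ⌊n²/2⌋+2`,
Landsberg–Manivel–Ressayre's `n²/2` plus one. -/
theorem not_inBorder_of_fanoByOne {n : ℕ} (hn : Odd n) (hF : FanoByOne n) :
    ¬ InBorder n (n ^ 2 / 2 + 1) := by
  intro hB
  obtain ⟨y, hy, hmax⟩ := hF
  obtain ⟨W, hdim, hflat⟩ := stub_borderKernelPlane hB y hy
  have hnull : PerNull n (W ⊔ (ℂ ∙ y)) := linearClosure y W hflat
  have hyW' : y ∈ W ⊔ (ℂ ∙ y) := Submodule.mem_sup_right (Submodule.mem_span_singleton_self y)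
  have hle : Module.finrank ℂ W ≤ Module.finrank ℂ (W ⊔ (ℂ ∙ y) : Submodule ℂ _) :=
    Submodule.finrank_mono le_sup_left
  have hbound := hmax _ hyW' hnull
  have hsq : n ^ 2 % 2 = 1 := Nat.odd_iff.mp hn.pow
  set N := n ^ 2 with hN
  omega

/-- **Composition 2 (kernel-checked modulo L1): `FanoByOne` at infinitely many odd `n` REFUTES the
crux `RefutationBarrier`**, modulo the named analytic fact `skodaBrownawellDegreeBound` (landed
`not_refutationBarrier_of_io_notInBorder`, degree-`n⁹` Hermitian-SOS certificates). -/
theorem not_refutationBarrier_of_fanoByOne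
    (hSB : ∀ n m : ℕ, skodaBrownawellDegreeBound (σ := Unk n m) (ι := (Fin n × Fin n) →₀ ℕ))
    (h : ∀ n₀ : ℕ, ∃ n ≥ n₀, Odd n ∧ FanoByOne n) : ¬ RefutationBarrier :=
  not_refutationBarrier_of_io_notInBorder hSB fun n₀ => by
    obtain ⟨n, hn, hodd, hF⟩ := h n₀
    exact ⟨n, hn, not_inBorder_of_fanoByOne hodd hF⟩

/-- The crux is matched BY NAME (sanity). -/
example : RefutationBarrier ↔
    ∀ c : ℕ, ∃ n₀ : ℕ, ∀ n ≥ n₀, ∀ m : ℕ, n ^ 2 / 2 + 1 ≤ m → ¬ HasSosRef n m (n ^ c) :=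
  refutationBarrier_iff

end Summit.ValiantsHypothesis.ValiantsHypothesis.Cruxes.RefutationBarrier.FanoByOne

end
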